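import Mathlib
import Summits.Ventures.PercRepro2.K5TypedSimple

/-!
# LOOPS: THE TYPED BASES ON EVERY ALL-MARKED `Reduced` INSTANCE
(blind cell PercRepro2, typer-1 g9)

`K5TypedSimple.lean` needs no loops.  A loop never changes a cluster, so the typed counts of a graph
with loops factor: the open graph of `ω` is the open graph of the restriction of `ω` to the non-loop
edges (`openGraph_res`), the state kernels `KII` / `KI` factor through that restriction (`KII_res`,
`KI_res`), and a typed count of a kernel that ignores the loop edges is the typed count of the
loop-free graph times the (nonnegative) number of typed loop triples (`typedCount_factor`, via the
splitting `splitTriple` of a triple of configurations into its non-loop and loop parts).  Hence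

* **`typedII_reduced`**, **`typedI_reduced`**: `CaseOne.TypedII ends o a₁ a₂ a₃ b` / `TypedI` on every
  graph on five marked vertices without parallel non-loop edges — p2's `Reduced` condition on the edges
  (`∀ e₁ e₂, e₁ ≠ e₂ → ¬ (ends e₁).IsDiag → ends e₁ ≠ ends e₂`) with every vertex marked, loops
  allowed: the all-marked base of the (TRI) architecture, exactly as the reduction calculus states it.
-/

namespace Summit.Ventures.PercRepro2

open Hub

namespace K5

section Restrict

variable {V : Type*} {E : Type*} (ends : E → Sym2 V)

/-- The ends of the non-loop edges. -/
def ends₀ : {e : E // ¬ (ends e).IsDiag} → Sym2 V := fun e => ends e.val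

/-- The restriction of a configuration to the non-loop edges. -/
def res (ω : Config E) : Config {e : E // ¬ (ends e).IsDiag} := fun e => ω e.val

/-- The restriction of a configuration to the loops. -/
def resL (ω : Config E) : Config {e : E // (ends e).IsDiag} := fun e => ω e.val

/-- Open adjacency between distinct vertices only uses non-loop edges. -/
lemma openAdj_res (ω : Config E) {u v : V} (huv : u ≠ v) :
    OpenAdj ends ω u v ↔ OpenAdj (ends₀ ends) (res ends ω) u v := by
  constructor
  · rintro ⟨e, he, hends⟩
    refine ⟨⟨e, ?_⟩, he, hends⟩
    rw [hends, Sym2.mk_isDiag_iff]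
    exact huv
  · rintro ⟨e, he, hends⟩
    exact ⟨e.val, he, hends⟩

/-- The open graph ignores the loops. -/
lemma openGraph_res (ω : Config E) : openGraph ends ω = openGraph (ends₀ ends) (res ends ω) := by
  ext u v
  rw [openGraph_adj, openGraph_adj]
  constructor
  · rintro ⟨huv, h⟩
    exact ⟨huv, (openAdj_res ends ω huv).1 h⟩
  · rintro ⟨huv, h⟩
    exact ⟨huv, (openAdj_res ends ω huv).2 h⟩

/-- Connectivity ignores the loops. -/
lemma conn_res (ω : Config E) (u v : V) : Conn ends ω u v ↔ Conn (ends₀ ends) (res ends ω) u v := by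
  unfold Conn
  rw [openGraph_res]

/-- Connectivity events are preimages under the restriction. -/
lemma connEvent_eq_preimage_res (u v : V) :
    connEvent ends u v = res ends ⁻¹' connEvent (ends₀ ends) u v := by
  ext ω
  exact conn_res ends ω u v

variable {R : Type*} [Field R]

/-- The indicator of a preimage under the restriction. -/
lemma indicator_res (S : Set (Config {e : E // ¬ (ends e).IsDiag})) (x : Config E) :
    (res ends ⁻¹' S).indicator (1 : Config E → R) x =
      S.indicator (1 : Config {e : E // ¬ (ends e).IsDiag} → R) (res ends x) := by
  by_cases h : res ends x ∈ S
  · rw [Set.indicator_of_mem h, Set.indicator_of_mem (Set.mem_preimage.2 h)]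
    rfl
  · rw [Set.indicator_of_notMem h, Set.indicator_of_notMem (fun h' => h (Set.mem_preimage.1 h'))]

/-- The state kernel `KII` factors through the restriction to the non-loop edges. -/
lemma KII_res (o a₁ a₂ a₃ b : V) (x y w : Config E) :
    CaseOne.KII (R := R) ends o a₁ a₂ a₃ b x y w =
      CaseOne.KII (R := R) (ends₀ ends) o a₁ a₂ a₃ b (res ends x) (res ends y) (res ends w) := by
  unfold CaseOne.KII CovForm.sepKernel CaseOne.iQ CaseOne.iA CaseOne.iQB CaseOne.iAB CaseOne.iAO
    CaseOne.iABO CaseOne.iPDc CaseOne.iPDoU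
  simp only [Fin.sum_univ_succ, Fin.sum_univ_zero, Matrix.cons_val_zero, Matrix.cons_val_succ,
    add_zero, connEvent_eq_preimage_res ends, ← Set.preimage_compl, ← Set.preimage_inter,
    ← Set.preimage_union, indicator_res]

/-- The state kernel `KI` factors through the restriction to the non-loop edges. -/
lemma KI_res (o a₁ a₂ a₃ b : V) (x y w : Config E) :
    CaseOne.KI (R := R) ends o a₁ a₂ a₃ b x y w =
      CaseOne.KI (R := R) (ends₀ ends) o a₁ a₂ a₃ b (res ends x) (res ends y) (res ends w) := by
  unfold CaseOne.KI CovForm.sepKernel CaseOne.iQ CaseOne.iA CaseOne.iQB₁ CaseOne.iAB₁ CaseOne.iAO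
    CaseOne.iAB₁O CaseOne.iPDc CaseOne.iPDoU
  simp only [Fin.sum_univ_succ, Fin.sum_univ_zero, Matrix.cons_val_zero, Matrix.cons_val_succ,
    add_zero, connEvent_eq_preimage_res ends, ← Set.preimage_compl, ← Set.preimage_inter,
    ← Set.preimage_union, indicator_res]

end Restrict

section Split

variable {V : Type*} {E : Type*} [DecidableEq V] (ends : E → Sym2 V)

/-- Gluing a configuration of the non-loop edges and one of the loops. -/
def glue (x₀ : Config {e : E // ¬ (ends e).IsDiag}) (xL : Config {e : E // (ends e).IsDiag}) :
    Config E := fun e => if h : (ends e).IsDiag then xL ⟨e, h⟩ else x₀ ⟨e, h⟩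

/-- The non-loop restriction of a glued configuration is its non-loop part. -/
lemma res_glue (x₀ : Config {e : E // ¬ (ends e).IsDiag}) (xL : Config {e : E // (ends e).IsDiag}) :
    res ends (glue ends x₀ xL) = x₀ := by
  funext e
  unfold res glue
  rw [dif_neg e.2]

/-- The loop restriction of a glued configuration is its loop part. -/
lemma resL_glue (x₀ : Config {e : E // ¬ (ends e).IsDiag}) (xL : Config {e : E // (ends e).IsDiag}) :
    resL ends (glue ends x₀ xL) = xL := by
  funext e
  unfold resL glue
  rw [dif_pos e.2]

/-- Gluing the two restrictions gives back the configuration. -/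
lemma glue_res (ω : Config E) : glue ends (res ends ω) (resL ends ω) = ω := by
  funext e
  unfold glue res resL
  split_ifs <;> rfl

/-- The splitting of a triple of configurations into its non-loop and loop parts. -/
def splitTriple : Config E × Config E × Config E ≃
    (Config {e : E // ¬ (ends e).IsDiag} × Config {e : E // ¬ (ends e).IsDiag} ×
        Config {e : E // ¬ (ends e).IsDiag}) ×
      (Config {e : E // (ends e).IsDiag} × Config {e : E // (ends e).IsDiag} ×
        Config {e : E // (ends e).IsDiag}) where
  toFun t := ((res ends t.1, res ends t.2.1, res ends t.2.2),
    (resL ends t.1, resL ends t.2.1, resL ends t.2.2))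
  invFun s := (glue ends s.1.1 s.2.1, glue ends s.1.2.1 s.2.2.1, glue ends s.1.2.2 s.2.2.2)
  left_inv t := by
    obtain ⟨x, y, w⟩ := t
    simp only [glue_res]
  right_inv s := by
    obtain ⟨⟨x₀, y₀, w₀⟩, ⟨xL, yL, wL⟩⟩ := s
    simp only [res_glue, resL_glue]

end Split

section Factor

variable {E : Type*} [Fintype E] [DecidableEq E]

omit [Fintype E] [DecidableEq E] in
/-- A universal statement over `E` splits along a decidable predicate. -/
lemma forall_split (p : E → Prop) [DecidablePred p] (Q : E → Prop) :
    (∀ e, Q e) ↔ (∀ e : {e // p e}, Q e.val) ∧ (∀ e : {e // ¬ p e}, Q e.val) :=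
  ⟨fun h => ⟨fun e => h e.val, fun e => h e.val⟩,
    fun h e => if hp : p e then h.1 ⟨e, hp⟩ else h.2 ⟨e, hp⟩⟩

/-- The constraint of a typed count, as a predicate on triples. -/
def tcond (F : Finset E) (z : Config E) (τ : E → ℕ) (t : Config E × Config E × Config E) : Prop :=
  (∀ e, e ∉ F → t.1 e = z e ∧ t.2.1 e = z e ∧ t.2.2 e = z e) ∧
    (∀ e ∈ F, openCount t.1 t.2.1 t.2.2 e = τ e)

/-- The constraint is decidable. -/
instance (F : Finset E) (z : Config E) (τ : E → ℕ) : DecidablePred (tcond F z τ) := fun t =>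
  inferInstanceAs (Decidable ((∀ e, e ∉ F → t.1 e = z e ∧ t.2.1 e = z e ∧ t.2.2 e = z e) ∧
    (∀ e ∈ F, openCount t.1 t.2.1 t.2.2 e = τ e)))

variable {R : Type*} [CommRing R]

/-- A typed count as one sum over the triples, with the constraint `tcond`. -/
lemma typedCount_eq_sum_tcond (F : Finset E) (z : Config E) (τ : E → ℕ)
    (K : Config E → Config E → Config E → R) :
    typedCount F z τ K = ∑ t : Config E × Config E × Config E,
      if tcond F z τ t then K t.1 t.2.1 t.2.2 else 0 := by
  rw [typedCount_eq_sum_triples]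
  rfl

/-- A typed count of a kernel equal to `1` is nonnegative (it is a number of triples). -/
lemma typedCount_one_nonneg [LinearOrder R] [IsStrictOrderedRing R] (F : Finset E) (z : Config E)
    (τ : E → ℕ) : 0 ≤ typedCount F z τ (fun _ _ _ => (1 : R)) := by
  unfold typedCount
  refine Finset.sum_nonneg fun x _ => Finset.sum_nonneg fun y _ => Finset.sum_nonneg fun w _ => ?_
  split_ifs <;> norm_num

variable {V : Type*} [DecidableEq V] (ends : E → Sym2 V)

omit [Fintype E] [DecidableEq E] in
/-- The constraint of a triple is the conjunction of the constraints of its two parts. -/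
lemma tcond_split (F : Finset E) (z : Config E) (τ : E → ℕ) (t : Config E × Config E × Config E) :
    tcond F z τ t ↔
      tcond (F.subtype fun e => ¬ (ends e).IsDiag) (res ends z) (fun e => τ e.val)
          (splitTriple ends t).1 ∧
        tcond (F.subtype fun e => (ends e).IsDiag) (resL ends z) (fun e => τ e.val)
          (splitTriple ends t).2 := by
  simp only [tcond, splitTriple, Equiv.coe_fn_mk, res, resL, Finset.mem_subtype, openCount]
  rw [forall_split (fun e => (ends e).IsDiag)
      (fun e => e ∉ F → t.1 e = z e ∧ t.2.1 e = z e ∧ t.2.2 e = z e),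
    forall_split (fun e => (ends e).IsDiag)
      (fun e => e ∈ F → (t.1 e).toNat + (t.2.1 e).toNat + (t.2.2 e).toNat = τ e)]
  tauto

/-- **Loops factor out of typed counts**: for a kernel that only sees the non-loop edges, the typed
count is the typed count of the loop-free graph times the number of typed loop triples. -/
theorem typedCount_factor (F : Finset E) (z : Config E) (τ : E → ℕ)
    (K₀ : Config {e : E // ¬ (ends e).IsDiag} → Config {e : E // ¬ (ends e).IsDiag} →
      Config {e : E // ¬ (ends e).IsDiag} → R) :
    typedCount F z τ (fun x y w => K₀ (res ends x) (res ends y) (res ends w)) =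
      typedCount (F.subtype fun e => ¬ (ends e).IsDiag) (res ends z) (fun e => τ e.val) K₀ *
        typedCount (F.subtype fun e => (ends e).IsDiag) (resL ends z) (fun e => τ e.val)
          (fun _ _ _ => (1 : R)) := by
  rw [typedCount_eq_sum_tcond, typedCount_eq_sum_tcond, typedCount_eq_sum_tcond, Finset.sum_mul_sum]
  refine (Fintype.sum_equiv (splitTriple ends) _
    (fun s => (if tcond (F.subtype fun e => ¬ (ends e).IsDiag) (res ends z) (fun e => τ e.val) s.1
        then K₀ s.1.1 s.1.2.1 s.1.2.2 else 0) *
      (if tcond (F.subtype fun e => (ends e).IsDiag) (resL ends z) (fun e => τ e.val) s.2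
        then (1 : R) else 0)) fun t => ?_).trans ?_
  · have hs := tcond_split ends F z τ t
    by_cases h1 : tcond (F.subtype fun e => ¬ (ends e).IsDiag) (res ends z) (fun e => τ e.val)
        (splitTriple ends t).1 <;>
      by_cases h2 : tcond (F.subtype fun e => (ends e).IsDiag) (resL ends z) (fun e => τ e.val)
        (splitTriple ends t).2
    · rw [if_pos (hs.2 ⟨h1, h2⟩), if_pos h1, if_pos h2, mul_one]
      rfl
    · rw [if_neg (fun h => h2 (hs.1 h).2), if_neg h2, mul_zero]
    · rw [if_neg (fun h => h1 (hs.1 h).1), if_neg h1, zero_mul]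
    · rw [if_neg (fun h => h1 (hs.1 h).1), if_neg h1, zero_mul]
  · simp only [Fintype.sum_prod_type]

end Factor

section Theorems

variable {V : Type*} {E : Type*} [Fintype E] [DecidableEq E] [DecidableEq V]
variable (ι : V ≃ Fin 5) (ends : E → Sym2 V)
variable {R : Type*} [Field R] [LinearOrder R] [IsStrictOrderedRing R]

omit [Fintype E] [DecidableEq V] [LinearOrder R] [IsStrictOrderedRing R] in
/-- The non-loop edges of a graph without parallel non-loop edges are injective. -/
lemma ends₀_injective (hred : ∀ e₁ e₂, e₁ ≠ e₂ → ¬ (ends e₁).IsDiag → ends e₁ ≠ ends e₂) :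
    Function.Injective (ends₀ ends) := by
  intro e e' h
  by_contra hne
  exact hred e.val e'.val (fun h' => hne (Subtype.ext h')) e.2 h

/-- **THE TYPED `(ii)` ON EVERY ALL-MARKED `Reduced` INSTANCE** (five marked vertices, no parallel
non-loop edges, loops allowed). -/
theorem typedII_reduced (hred : ∀ e₁ e₂, e₁ ≠ e₂ → ¬ (ends e₁).IsDiag → ends e₁ ≠ ends e₂)
    (o a₁ a₂ a₃ b : V) (h₀ : ι o = 0) (h₁ : ι a₁ = 1) (h₂ : ι a₂ = 2) (h₃ : ι a₃ = 3) (h₄ : ι b = 4) :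
    CaseOne.TypedII (R := R) ends o a₁ a₂ a₃ b := by
  intro q G σ hq hpin _hσ
  rw [triSum_pinned_eq q G hpin σ]
  refine mul_nonneg (prod_typed_factors_nonneg q hq G σ) ?_
  have hK : CaseOne.KII (R := R) ends o a₁ a₂ a₃ b = fun x y w =>
      CaseOne.KII (R := R) (ends₀ ends) o a₁ a₂ a₃ b (res ends x) (res ends y) (res ends w) := by
    funext x y w
    exact KII_res ends o a₁ a₂ a₃ b x y w
  rw [hK, typedCount_factor]
  refine mul_nonneg ?_ (typedCount_one_nonneg _ _ _)
  rw [typedCount_KII_eq ι (ends₀ ends) (fun e => e.2) (ends₀_injective ends hred), h₀, h₁, h₂, h₃,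
    h₄]
  exact typedCount_KII_nonneg _ _ _

/-- **THE TYPED `(i)` ON EVERY ALL-MARKED `Reduced` INSTANCE** (five marked vertices, no parallel
non-loop edges, loops allowed). -/
theorem typedI_reduced (hred : ∀ e₁ e₂, e₁ ≠ e₂ → ¬ (ends e₁).IsDiag → ends e₁ ≠ ends e₂)
    (o a₁ a₂ a₃ b : V) (h₀ : ι o = 0) (h₁ : ι a₁ = 1) (h₂ : ι a₂ = 2) (h₃ : ι a₃ = 3) (h₄ : ι b = 4) :
    CaseOne.TypedI (R := R) ends o a₁ a₂ a₃ b := by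
  intro q G σ hq hpin _hσ
  rw [triSum_pinned_eq q G hpin σ]
  refine mul_nonneg (prod_typed_factors_nonneg q hq G σ) ?_
  have hK : CaseOne.KI (R := R) ends o a₁ a₂ a₃ b = fun x y w =>
      CaseOne.KI (R := R) (ends₀ ends) o a₁ a₂ a₃ b (res ends x) (res ends y) (res ends w) := by
    funext x y w
    exact KI_res ends o a₁ a₂ a₃ b x y w
  rw [hK, typedCount_factor]
  refine mul_nonneg ?_ (typedCount_one_nonneg _ _ _)
  rw [typedCount_KI_eq ι (ends₀ ends) (fun e => e.2) (ends₀_injective ends hred), h₀, h₁, h₂, h₃,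
    h₄]
  exact typedCount_KI_nonneg _ _ _

end Theorems

end K5

end Summit.Ventures.PercRepro2
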